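import Summits.AtomisticToContinuum.BoseEinsteinCondensation.Theorems.BECInsertionCorrectorCorrectorClosureLongWaveStructureOfSRBMinimiser
import Summits.AtomisticToContinuum.BoseEinsteinCondensation.Theorems.BECInsertionCorrectorCorrectorClosureLongWaveStructureOfSRBParseval
import Summits.AtomisticToContinuum.BoseEinsteinCondensation.Theses.BECPhaseQuadratureSumRule
import HarnessLib

/-!
# Crux `CorrectorClosure` (stmt-AtomisticToContinuum-12058), line `volume-homotopy-sum-rule-domination` —
# registered stub `stub_longWaveStructureOfSRB` (S1): K1 ⇒ the density-uniform long-wave structure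
# bound (the body of PQSR's `LongWaveStructureBound`, item 12617, at coupling `t = 1`, all `N ≥ 1`)

Supports (does not close) stmt-AtomisticToContinuum-12058, route `BECInsertionCorrector`.

**Statement.** Given `StaticResponseBound` (K1), for every smooth-class `v`, every `K, ε > 0` there is
`ρ₀ > 0` such that for EVERY `N ≥ 1`, every box `L > 0` with `N/L³ < ρ₀` and `L ≤ K²Na` (the sliding box
fits, `ℓ ≤ L`) and every exact minimiser `Ψ` at `(N, L)`: with `ρ_L = N/L³`, `ℓ = (K√(ρ_L a))⁻¹`,
`∫_cell ∫_{cell^N} (Σⱼ Σ_m 1[xⱼ + Lm ∈ Λ_ℓ(u)])² |Ψ|² dX du ≤ (1+ε)(ρ_Lℓ³)² L³`.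

**Proof.** (1) `sq_moment_le_of_staticResponseBound` (aux file 1): K1 gives `ρ₁ > 0`, `S ≥ 0` with
`‖ρ_p†Ψ‖² ≤ S N` for every exact minimiser `Ψ` at every `(N, L)` with `N/L³ < ρ₁` and every `p ≠ 0`
(kill-edge `hyperuniformity_of_staticResponseBound` on the positive translation-invariant minimiser,
rigidity of the modulus). (2) `boxMoment_le_of_sq_moment_le` (aux file 3; Parseval in the box centre,
aux file 2): the box moment is `≤ N²ℓ⁶/L³ + 27 S N ℓ³` as soon as `0 ≤ ℓ ≤ L`. (3) Arithmetic
(`lw_arith`, `lw_box_fits`): with `t = √(ρ_L a)`, `ℓ K t = 1` and `t² L³ = N a`, the side condition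
`L ≤ K²Na` is `ℓ ≤ L`, `(ρ_L ℓ³)² L³ = N²ℓ⁶/L³`, and `27 S N ℓ³ ≤ ε N²ℓ⁶/L³ ⟺ 27 S K³ a t ≤ ε`, which
holds for `ρ_L < ρ₀ := min(ρ₁, ε²/(D²(a+1)))`, `D = 27 S K³ a + 1`; `a = 0` makes the side condition
read `L ≤ 0`, vacuous.

## References

* [Stringari1995] S. Stringari, *Sum rules and Bose–Einstein condensation*, §3 (40).
* [PitaevskiiStringari1991] L. Pitaevskii, S. Stringari, *Uncertainty principle, quantum fluctuations
  and broken symmetries*, (8)–(11).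
-/

noncomputable section

open MeasureTheory Filter Matrix
open scoped ENNReal NNReal BigOperators ComplexConjugate

namespace Summit.AtomisticToContinuum.BoseEinsteinCondensation.Theorems.CorrectorClosure.VolumeHomotopySumRuleDomination

open Literature.MathematicalPhysics.QuantumManyBody.BoseGas
open Summit.AtomisticToContinuum.BoseEinsteinCondensation.Theses.BECInsertionCorrector

/-! ### Real-variable bookkeeping -/

/-- **The box fits**: with `t² L³ = N a` (`t = √(ρ_L a)`), the side condition `L ≤ K² N a` is
`ℓ = (K t)⁻¹ ≤ L`. [folklore] -/
theorem lw_box_fits {K t L Nr a : ℝ} (hK : 0 < K) (ht : 0 < t) (hL : 0 < L)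
    (ht2 : t ^ 2 * L ^ 3 = Nr * a) (hside : L ≤ K ^ 2 * Nr * a) : (K * t)⁻¹ ≤ L := by
  have hKt : 0 < K * t := mul_pos hK ht
  rw [inv_le_comm₀ hKt hL]
  have h1 : (K * t) ^ 2 * L ^ 3 = K ^ 2 * (Nr * a) := by rw [← ht2]; ring
  have hsq : L⁻¹ ^ 2 ≤ (K * t) ^ 2 := by
    rw [inv_pow, ← one_div, div_le_iff₀ (by positivity)]
    have h2 : L * 1 ≤ L * ((K * t) ^ 2 * L ^ 2) :=
      calc L * 1 = L := mul_one L
        _ ≤ K ^ 2 * Nr * a := hside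
        _ = (K * t) ^ 2 * L ^ 3 := by rw [h1]; ring
        _ = L * ((K * t) ^ 2 * L ^ 2) := by ring
    exact le_of_mul_le_mul_left h2 hL
  exact (pow_le_pow_iff_left₀ (by positivity) hKt.le two_ne_zero).1 hsq

/-- **The error budget**: with `ℓ K t = 1`, `t² L³ = N a` and `27 S K³ a t ≤ ε`,
`N²ℓ⁶/L³ + 27 S N ℓ³ ≤ (1+ε) (N/L³ · ℓ³)² L³`. [folklore] -/
theorem lw_arith {S K a t L ℓ Nr ε : ℝ} (hK : 0 < K) (ht : 0 < t) (hL : 0 < L) (hN : 0 < Nr)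
    (hℓ : ℓ * (K * t) = 1) (ht2 : t ^ 2 * L ^ 3 = Nr * a) (hkey : 27 * S * K ^ 3 * a * t ≤ ε) :
    Nr ^ 2 * ℓ ^ 6 / L ^ 3 + 27 * S * Nr * ℓ ^ 3 ≤ (1 + ε) * (Nr / L ^ 3 * ℓ ^ 3) ^ 2 * L ^ 3 := by
  have hKt : 0 < K * t := mul_pos hK ht
  have hℓpos : 0 < ℓ := by
    have hℓ' : ℓ = (K * t)⁻¹ := eq_inv_of_mul_eq_one_left hℓ
    rw [hℓ']
    positivity
  have hmain : (1 + ε) * (Nr / L ^ 3 * ℓ ^ 3) ^ 2 * L ^ 3 =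
      Nr ^ 2 * ℓ ^ 6 / L ^ 3 + ε * Nr * (Nr * ℓ ^ 3) * ℓ ^ 3 / L ^ 3 := by
    field_simp
  -- the error term: `27 S L³ ≤ ε N ℓ³`
  have herr : 27 * S * L ^ 3 ≤ ε * (Nr * ℓ ^ 3) := by
    have hu3 : 0 < (K * t) ^ 3 := by positivity
    refine le_of_mul_le_mul_right ?_ hu3
    calc 27 * S * L ^ 3 * (K * t) ^ 3 = 27 * S * K ^ 3 * t * (t ^ 2 * L ^ 3) := by ring
      _ = Nr * (27 * S * K ^ 3 * a * t) := by rw [ht2]; ring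
      _ ≤ Nr * ε := mul_le_mul_of_nonneg_left hkey hN.le
      _ = ε * Nr * (ℓ * (K * t)) ^ 3 := by rw [hℓ]; ring
      _ = ε * (Nr * ℓ ^ 3) * (K * t) ^ 3 := by ring
  rw [hmain]
  refine add_le_add le_rfl ?_
  rw [le_div_iff₀ (by positivity)]
  calc 27 * S * Nr * ℓ ^ 3 * L ^ 3 = Nr * ℓ ^ 3 * (27 * S * L ^ 3) := by ring
    _ ≤ Nr * ℓ ^ 3 * (ε * (Nr * ℓ ^ 3)) := mul_le_mul_of_nonneg_left herr (by positivity)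
    _ = ε * Nr * (Nr * ℓ ^ 3) * ℓ ^ 3 := by ring

/-- **The density threshold**: if `t² = ρ_L a < ρ₀ a` with `ρ₀ ≤ ε²/(D²(a+1))`, `D = 27 S K³ a + 1`, then
`27 S K³ a t ≤ ε`. [folklore] -/
theorem lw_key {S K a t ρL ρ₀ ε : ℝ} (hS : 0 ≤ S) (hK : 0 < K) (ha : 0 < a) (ht : 0 ≤ t) (hε : 0 < ε)
    (ht2 : t ^ 2 = ρL * a) (hρ : ρL < ρ₀)
    (hρ₀ : ρ₀ ≤ ε ^ 2 / ((27 * S * K ^ 3 * a + 1) ^ 2 * (a + 1))) :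
    27 * S * K ^ 3 * a * t ≤ ε := by
  set D : ℝ := 27 * S * K ^ 3 * a + 1 with hD
  have hDpos : 0 < D := by positivity
  have h1 : t ^ 2 < (ε / D) ^ 2 :=
    calc t ^ 2 = ρL * a := ht2
      _ < ρ₀ * a := mul_lt_mul_of_pos_right hρ ha
      _ ≤ ε ^ 2 / (D ^ 2 * (a + 1)) * a := mul_le_mul_of_nonneg_right hρ₀ ha.le
      _ ≤ (ε / D) ^ 2 := by
          rw [div_pow, div_mul_eq_mul_div, div_le_div_iff₀ (by positivity) (by positivity)]
          nlinarith [mul_nonneg (sq_nonneg ε) (sq_nonneg D), ha.le]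
  have h2 : t < ε / D := lt_of_pow_lt_pow_left₀ 2 (by positivity) h1
  have h3 : t * D < ε := (lt_div_iff₀ hDpos).1 h2
  have h4 : t * D = 27 * S * K ^ 3 * a * t + t := by rw [hD]; ring
  linarith

/-! ### The registered stub -/

/-- **S1 `stub_longWaveStructureOfSRB` — K1 ⇒ density-uniform long-wave structure bound
(Onsager–Price), the K1-consuming brick of the line.** Given `StaticResponseBound`, for every
smooth-class `v`, every `K, ε > 0` there is `ρ₀ > 0` such that for EVERY `N ≥ 1`, every box `L > 0`
with `N/L³ < ρ₀` in which the sliding box fits (`L ≤ K²Na`, i.e. `ℓ ≤ L`) and every minimiser `Ψ` at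
`(N, L)`: with `ρ_L = N/L³`, `ℓ = (K√(ρ_L a))⁻¹` and periodised sliding boxes `Λ_u(ℓ)`,
`∫_cell E_Ψ[N_{Λ_u}²] du ≤ (1+ε)(ρ_Lℓ³)² L³` — verbatim the body of PQSR's `LongWaveStructureBound`
(item 12617) at `t = 1` with `sideLength ρ N ↦ L`, `ρ ↦ N/L³`, for all `N`.  Proof: the structure bound
`‖ρ_p†Ψ‖² ≤ S N` (`p ≠ 0`) for every minimiser in every box with `N/L³ < ρ₁`
(`sq_moment_le_of_staticResponseBound`: kill-edge `hyperuniformity_of_staticResponseBound` on the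
positive translation-invariant minimiser + rigidity of the modulus), Parseval in the box centre
(`boxMoment_le_of_sq_moment_le`: box moment `≤ N²ℓ⁶/L³ + 27 S N ℓ³` for `ℓ ≤ L`), and the threshold
`ρ₀ = min(ρ₁, ε²/(D²(a+1)))`, `D = 27 S K³a + 1`, which makes `27 S N ℓ³ ≤ ε N²ℓ⁶/L³`; `a = 0` is
vacuous (`L ≤ 0`). [cite: Stringari1995, §3 (40); PitaevskiiStringari1991, (8)–(11)] -/
theorem stub_longWaveStructureOfSRB (hK1 : StaticResponseBound) (v : ℝ → ℝ≥0∞)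
    (hv : IsRepulsiveFiniteRange v) (hfin : ∀ r, v r ≠ ⊤)
    (hC2 : ContDiff ℝ 2 (fun x : Space => (v ‖x‖).toReal))
    (hedge : ∃ Cₑ : ℝ, ∀ x : Space,
      ‖iteratedFDeriv ℝ 2 (fun x : Space => (v ‖x‖).toReal) x‖ ≤ Cₑ * Real.sqrt ((v ‖x‖).toReal)) :
    ∀ K : ℝ, 0 < K → ∀ ε : ℝ, 0 < ε → ∃ ρ₀ : ℝ, 0 < ρ₀ ∧ ∀ N : ℕ, 0 < N → ∀ L : ℝ, 0 < L →
      (N : ℝ) / L ^ 3 < ρ₀ → L ≤ K ^ 2 * (N : ℝ) * (scatteringLength v).toReal →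
      ∀ Ψ : PeriodicTrialState N L,
        periodicEnergy v Ψ = periodicGroundStateEnergy v N L → periodicEnergy v Ψ ≠ ⊤ →
        (let ρL : ℝ := (N : ℝ) / L ^ 3
         let ℓ : ℝ := (K * Real.sqrt (ρL * (scatteringLength v).toReal))⁻¹
         (∫⁻ u in cell L, ∫⁻ X in cellN N L,
            (∑ j : Fin N, ∑' m : Fin 3 → ℤ,
                (slidingBox ℓ u).indicator (fun _ => (1 : ℝ≥0∞)) (X j + latticeVec L m)) ^ 2 *
              (‖Ψ.ψ X‖₊ : ℝ≥0∞) ^ 2) ≤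
           ENNReal.ofReal ((1 + ε) * (ρL * ℓ ^ 3) ^ 2 * L ^ 3)) := by
  intro K hK ε hε
  obtain ⟨ρ₁, hρ₁, S, hS, hmom⟩ := sq_moment_le_of_staticResponseBound hK1 v hv hfin hC2 hedge
  -- the scattering length and the threshold
  set a : ℝ := (scatteringLength v).toReal with ha_def
  have ha0 : 0 ≤ a := ENNReal.toReal_nonneg
  refine ⟨min ρ₁ (ε ^ 2 / ((27 * S * K ^ 3 * a + 1) ^ 2 * (a + 1))), lt_min hρ₁ (by positivity), ?_⟩
  intro N hN L hL hρL hside Ψ hΨ hΨfin ρL ℓ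
  have hNr : (0 : ℝ) < N := by exact_mod_cast hN
  have hρ₁L : (N : ℝ) / L ^ 3 < ρ₁ := hρL.trans_le (min_le_left _ _)
  have hρεL : (N : ℝ) / L ^ 3 < ε ^ 2 / ((27 * S * K ^ 3 * a + 1) ^ 2 * (a + 1)) :=
    hρL.trans_le (min_le_right _ _)
  -- `a = 0` is vacuous
  rcases ha0.eq_or_lt with ha | ha
  · exfalso
    rw [← ha, mul_zero] at hside
    linarith
  -- the scales: `ρ_L = N/L³`, `t = √(ρ_L a)`, `ℓ = (K t)⁻¹`
  have hρL_val : ρL = (N : ℝ) / L ^ 3 := rfl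
  have hρLpos : 0 < ρL := by rw [hρL_val]; positivity
  set t : ℝ := Real.sqrt (ρL * a) with ht_def
  have hℓ_val : ℓ = (K * t)⁻¹ := rfl
  have htpos : 0 < t := Real.sqrt_pos.2 (by positivity)
  have ht2' : t ^ 2 = ρL * a := Real.sq_sqrt (by positivity)
  have ht2 : t ^ 2 * L ^ 3 = N * a := by
    rw [ht2', hρL_val]
    field_simp
  have hKt : 0 < K * t := mul_pos hK htpos
  have hℓpos : 0 < ℓ := by rw [hℓ_val]; positivity
  have hℓKt : ℓ * (K * t) = 1 := by rw [hℓ_val]; exact inv_mul_cancel₀ hKt.ne'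
  -- the box fits
  have hℓL : ℓ ≤ L := by rw [hℓ_val]; exact lw_box_fits hK htpos hL ht2 hside
  -- K1's structure bound for `Ψ`, and Parseval in the box centre
  have hmode := hmom N hN L hL hρ₁L Ψ hΨ hΨfin
  have hBM := boxMoment_le_of_sq_moment_le hL hℓpos.le hℓL Ψ hS hmode
  refine hBM.trans (ENNReal.ofReal_le_ofReal ?_)
  -- the threshold makes the error term an `ε`-fraction of the main term
  have hkey : 27 * S * K ^ 3 * a * t ≤ ε :=
    lw_key hS hK ha htpos.le hε ht2' (hρL_val ▸ hρεL) le_rfl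
  exact lw_arith hK htpos hL hNr hℓKt ht2 hkey

end Summit.AtomisticToContinuum.BoseEinsteinCondensation.Theorems.CorrectorClosure.VolumeHomotopySumRuleDomination

end
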